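import Summits.Ventures.PercRepro0.Merge

/-!
# The tree inside the box (UNIQUENESS-p6-v1 §3, Lemmas 3.2–3.3), seat p6

Kernel-checked twin, on `Defs.lean`, of the combinatorial construction behind the creation of a
trifurcation: given three distinct «face» vertices `b i` outside the box `Λ_n`, each adjacent to a vertex
`u i` of `Λ_n`, there are a centre `v ∈ Λ_n` and three lattice paths `v → b i` whose vertices other than
`b i` lie in `Λ_n` and which pairwise meet only in `v` (`exists_tripod`). The paper's spanning tree and
Lemma 3.2 are replaced by two box paths (`u 0 → u 1` and `u 2 → u 0`, made into paths by `bypass`), the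
second cut at its first vertex on the first (`exists_cut_first_mem`), and the pendant bonds `u i – b i`.

Everything here is deterministic graph theory on the lattice `𝕃^d`; the probabilistic use (finite energy
with the constant inside choice «exactly the tripod open») is in `TrifCreate.lean`.
-/

namespace Summit.Ventures.PercRepro0.Tripod

open Set Function
open Summit.Ventures.PercRepro0.Defs

variable {d : ℕ}

/-! ## Cutting a walk at its first vertex in a set -/

section General

variable {V : Type*} {G : SimpleGraph V}

/-- A walk meeting `S` splits as `r.append r'` at its first vertex `w ∈ S`: no vertex of `r` other than
`w` lies in `S`. -/
theorem exists_cut_first_mem (S : Set V) :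
    ∀ {a b : V} (q : G.Walk a b), (∃ y ∈ q.support, y ∈ S) →
      ∃ w ∈ S, ∃ (r : G.Walk a w) (r' : G.Walk w b), r.append r' = q ∧
        ∀ y ∈ r.support, y ∈ S → y = w := by
  intro a b q
  induction q with
  | nil =>
    rintro ⟨y, hy, hyS⟩
    rw [SimpleGraph.Walk.support_nil, List.mem_singleton] at hy
    subst hy
    refine ⟨_, hyS, SimpleGraph.Walk.nil, SimpleGraph.Walk.nil, rfl, fun z hz _ => ?_⟩
    rw [SimpleGraph.Walk.support_nil, List.mem_singleton] at hz
    exact hz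
  | @cons u v b h q ih =>
    rintro ⟨y, hy, hyS⟩
    by_cases hu : u ∈ S
    · refine ⟨u, hu, SimpleGraph.Walk.nil, SimpleGraph.Walk.cons h q, rfl, fun z hz _ => ?_⟩
      rw [SimpleGraph.Walk.support_nil, List.mem_singleton] at hz
      exact hz
    · have hy' : ∃ y ∈ q.support, y ∈ S := by
        rw [SimpleGraph.Walk.support_cons, List.mem_cons] at hy
        rcases hy with rfl | hy
        · exact absurd hyS hu
        · exact ⟨y, hy, hyS⟩
      obtain ⟨w, hw, r, r', hrr', hr⟩ := ih hy'
      refine ⟨w, hw, SimpleGraph.Walk.cons h r, r', by rw [SimpleGraph.Walk.cons_append, hrr'], ?_⟩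
      intro z hz hzS
      rw [SimpleGraph.Walk.support_cons, List.mem_cons] at hz
      rcases hz with rfl | hz
      · exact absurd hzS hu
      · exact hr z hz hzS

/-- The two halves of a path meet only in the cut vertex. -/
theorem eq_of_mem_support_append_isPath {a w b : V} {r : G.Walk a w} {r' : G.Walk w b}
    (hp : (r.append r').IsPath) {y : V} (hy : y ∈ r.support) (hy' : y ∈ r'.support) : y = w := by
  have hnd := hp.support_nodup
  rw [SimpleGraph.Walk.support_append, List.nodup_append'] at hnd
  rw [← SimpleGraph.Walk.cons_tail_support r', List.mem_cons] at hy'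
  rcases hy' with rfl | hy'
  · rfl
  · exact absurd hy' (hnd.2.2 hy)

end General

/-! ## Walks inside a box -/

/-- (N6) in walk form: two vertices of `Λ_n` are joined by a lattice walk all of whose vertices lie in
`Λ_n` (coordinate-wise unit steps). -/
theorem exists_walk_in_box {n : ℕ} {a b : Vertex d} (ha : a ∈ box d n) (hb : b ∈ box d n) :
    ∃ p : (lattice d).Walk a b, ∀ y ∈ p.support, y ∈ box d n := by
  classical
  suffices h : ∀ (m : ℕ) (a : Vertex d), a ∈ box d n → (∑ i, (b i - a i).natAbs) = m →
      ∃ p : (lattice d).Walk a b, ∀ y ∈ p.support, y ∈ box d n from h _ a ha rfl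
  intro m
  induction m with
  | zero =>
    intro a ha hm
    have : a = b := by
      funext i
      have h0 := (Finset.sum_eq_zero_iff.1 hm) i (Finset.mem_univ i)
      have := Int.natAbs_eq_zero.1 h0
      linarith
    subst this
    refine ⟨SimpleGraph.Walk.nil, fun y hy => ?_⟩
    rw [SimpleGraph.Walk.support_nil, List.mem_singleton] at hy
    subst hy
    exact ha
  | succ m ih =>
    intro a ha hm
    obtain ⟨i, hi⟩ : ∃ i, a i ≠ b i := by
      by_contra h
      push Not at h
      have : (∑ i, (b i - a i).natAbs) = 0 := Finset.sum_eq_zero fun i _ => by rw [h i]; simp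
      omega
    -- one unit step in coordinate `i` towards `b`
    set δ : ℤ := if a i < b i then 1 else -1 with hδ
    set a' : Vertex d := Function.update a i (a i + δ) with ha'def
    have ha'i : a' i = a i + δ := by simp [ha'def]
    have ha'j : ∀ j, j ≠ i → a' j = a j := fun j hj => by simp [ha'def, hj]
    have hai : |a i| ≤ n := ha i
    have hbi : |b i| ≤ n := hb i
    have ha' : a' ∈ box d n := by
      intro j
      by_cases hj : j = i
      · subst hj
        rw [ha'i]
        rw [abs_le] at hai hbi ⊢
        rw [hδ]
        split_ifs with hlt
        · constructor <;> linarith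
        · constructor <;> linarith [lt_of_le_of_ne (not_lt.1 hlt) (Ne.symm hi)]
      · rw [ha'j j hj]
        exact ha j
    have hadj : (lattice d).Adj a a' := by
      show (∑ j, |a j - a' j|) = 1
      rw [Finset.sum_eq_single i]
      · rw [ha'i, hδ]
        split_ifs <;> simp
      · intro j _ hj
        rw [ha'j j hj, sub_self, abs_zero]
      · intro h
        exact absurd (Finset.mem_univ i) h
    have hm' : (∑ j, (b j - a' j).natAbs) = m := by
      have hstep : ∀ j, (b j - a' j).natAbs + (if j = i then 1 else 0) = (b j - a j).natAbs := by
        intro j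
        by_cases hj : j = i
        · subst hj
          rw [ha'i, hδ]
          simp only [if_true]
          split_ifs with hlt
          · omega
          · have := lt_of_le_of_ne (not_lt.1 hlt) (Ne.symm hi)
            omega
        · rw [ha'j j hj]
          simp [hj]
      have hsum := Finset.sum_congr rfl fun j (_ : j ∈ Finset.univ) => hstep j
      rw [Finset.sum_add_distrib, Finset.sum_ite_eq' Finset.univ i, if_pos (Finset.mem_univ i),
        hm] at hsum
      omega
    obtain ⟨p', hp'⟩ := ih a' ha' hm'
    refine ⟨SimpleGraph.Walk.cons hadj p', fun y hy => ?_⟩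
    rw [SimpleGraph.Walk.support_cons, List.mem_cons] at hy
    rcases hy with rfl | hy
    · exact ha
    · exact hp' y hy

/-- A lattice PATH inside `Λ_n` between two of its vertices. -/
theorem exists_path_in_box {n : ℕ} {a b : Vertex d} (ha : a ∈ box d n) (hb : b ∈ box d n) :
    ∃ p : (lattice d).Walk a b, p.IsPath ∧ ∀ y ∈ p.support, y ∈ box d n := by
  classical
  obtain ⟨p, hp⟩ := exists_walk_in_box ha hb
  exact ⟨p.bypass, p.bypass_isPath, fun y hy => hp y (p.support_bypass_subset_support hy)⟩

/-! ## The tripod -/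

/-- Lemma 3.3 (tripod): given three distinct vertices `b i ∉ Λ_n`, each adjacent to a vertex `u i ∈ Λ_n`,
there are `v ∈ Λ_n` and three lattice paths `A i : v → b i` whose vertices other than `b i` lie in `Λ_n`,
pairwise meeting only in `v`. -/
theorem exists_tripod {n : ℕ} (b u : Fin 3 → Vertex d) (hu : ∀ i, u i ∈ box d n)
    (hb : ∀ i, b i ∉ box d n) (hadj : ∀ i, (lattice d).Adj (u i) (b i))
    (hne : ∀ i j, i ≠ j → b i ≠ b j) :
    ∃ v ∈ box d n, ∃ A : ∀ i : Fin 3, (lattice d).Walk v (b i),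
      (∀ i, (A i).IsPath) ∧ (∀ i, ∀ y ∈ (A i).support, y ≠ b i → y ∈ box d n) ∧
      ∀ i j, i ≠ j → ∀ y, y ∈ (A i).support → y ∈ (A j).support → y = v := by
  classical
  -- the first box path `u 0 → u 1` and the second `u 2 → u 0`
  obtain ⟨P, hPpath, hPbox⟩ := exists_path_in_box (hu 0) (hu 1)
  obtain ⟨Q, hQpath, hQbox⟩ := exists_path_in_box (hu 2) (hu 0)
  -- cut `Q` at its first vertex `w` on `P`
  obtain ⟨w, hwP, r, r', hrr', hr⟩ :=
    exists_cut_first_mem {y | y ∈ P.support} Q ⟨u 0, Q.end_mem_support, P.start_mem_support⟩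
  -- split `P` at `w`
  obtain ⟨w', hw', s, s', hss', -⟩ :=
    exists_cut_first_mem ({w} : Set (Vertex d)) P ⟨w, hwP, Set.mem_singleton w⟩
  rw [Set.mem_singleton_iff] at hw'
  subst w'
  have hwbox : w ∈ box d n := hPbox w hwP
  -- the pieces are paths
  have hs : s.IsPath := SimpleGraph.Walk.IsPath.of_append_left (hss' ▸ hPpath)
  have hs' : s'.IsPath := SimpleGraph.Walk.IsPath.of_append_right (hss' ▸ hPpath)
  have hrpath : r.IsPath := SimpleGraph.Walk.IsPath.of_append_left (hrr' ▸ hQpath)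
  -- the box parts of the three arms
  have hsbox : ∀ y ∈ s.support, y ∈ box d n := fun y hy =>
    hPbox y (by rw [← hss', SimpleGraph.Walk.mem_support_append_iff]; exact Or.inl hy)
  have hs'box : ∀ y ∈ s'.support, y ∈ box d n := fun y hy =>
    hPbox y (by rw [← hss', SimpleGraph.Walk.mem_support_append_iff]; exact Or.inr hy)
  have hrbox : ∀ y ∈ r.support, y ∈ box d n := fun y hy =>
    hQbox y (by rw [← hrr', SimpleGraph.Walk.mem_support_append_iff]; exact Or.inl hy)
  -- pairwise: the box parts meet only in `w`
  have hss'w : ∀ y, y ∈ s.support → y ∈ s'.support → y = w := fun y hy hy' =>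
    eq_of_mem_support_append_isPath (hss' ▸ hPpath) hy hy'
  have hsrw : ∀ y, y ∈ s.support → y ∈ r.support → y = w := fun y hy hy' =>
    hr y hy' (show y ∈ P.support by
      rw [← hss', SimpleGraph.Walk.mem_support_append_iff]; exact Or.inl hy)
  have hs'rw : ∀ y, y ∈ s'.support → y ∈ r.support → y = w := fun y hy hy' =>
    hr y hy' (show y ∈ P.support by
      rw [← hss', SimpleGraph.Walk.mem_support_append_iff]; exact Or.inr hy)
  -- the arms: reverse the pieces towards `w` and append the pendant bonds
  let A₀ : (lattice d).Walk w (b 0) := s.reverse.concat (hadj 0)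
  let A₁ : (lattice d).Walk w (b 1) := s'.concat (hadj 1)
  let A₂ : (lattice d).Walk w (b 2) := r.reverse.concat (hadj 2)
  let A : ∀ i : Fin 3, (lattice d).Walk w (b i) := fun i =>
    match i with
    | ⟨0, _⟩ => A₀
    | ⟨1, _⟩ => A₁
    | ⟨2, _⟩ => A₂
  -- supports of the arms
  have hA0 : ∀ y, y ∈ (A 0).support ↔ y ∈ s.support ∨ y = b 0 := by
    intro y
    show y ∈ (s.reverse.concat (hadj 0)).support ↔ _
    rw [SimpleGraph.Walk.support_concat, List.mem_append, List.mem_singleton,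
      SimpleGraph.Walk.support_reverse, List.mem_reverse]
  have hA1 : ∀ y, y ∈ (A 1).support ↔ y ∈ s'.support ∨ y = b 1 := by
    intro y
    show y ∈ (s'.concat (hadj 1)).support ↔ _
    rw [SimpleGraph.Walk.support_concat, List.mem_append, List.mem_singleton]
  have hA2 : ∀ y, y ∈ (A 2).support ↔ y ∈ r.support ∨ y = b 2 := by
    intro y
    show y ∈ (r.reverse.concat (hadj 2)).support ↔ _
    rw [SimpleGraph.Walk.support_concat, List.mem_append, List.mem_singleton,
      SimpleGraph.Walk.support_reverse, List.mem_reverse]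
  -- box parts as a family
  let X : Fin 3 → List (Vertex d) := ![s.support, s'.support, r.support]
  have hAX : ∀ i y, y ∈ (A i).support ↔ y ∈ X i ∨ y = b i := by
    intro i
    fin_cases i
    · exact hA0
    · exact hA1
    · exact hA2
  have hXbox : ∀ i, ∀ y ∈ X i, y ∈ box d n := by
    intro i
    fin_cases i
    · exact hsbox
    · exact hs'box
    · exact hrbox
  have hXw : ∀ i j, i ≠ j → ∀ y, y ∈ X i → y ∈ X j → y = w := by
    intro i j hij y hy hy'
    fin_cases i <;> fin_cases j
    · exact absurd rfl hij
    · exact hss'w y hy hy'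
    · exact hsrw y hy hy'
    · exact hss'w y hy' hy
    · exact absurd rfl hij
    · exact hs'rw y hy hy'
    · exact hsrw y hy' hy
    · exact hs'rw y hy' hy
    · exact absurd rfl hij
  refine ⟨w, hwbox, A, ?_, ?_, ?_⟩
  · -- paths
    intro i
    fin_cases i
    · show (s.reverse.concat (hadj 0)).IsPath
      refine hs.reverse.concat ?_ _
      rw [SimpleGraph.Walk.support_reverse, List.mem_reverse]
      exact fun h => hb 0 (hsbox _ h)
    · show (s'.concat (hadj 1)).IsPath
      exact hs'.concat (fun h => hb 1 (hs'box _ h)) _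
    · show (r.reverse.concat (hadj 2)).IsPath
      refine hrpath.reverse.concat ?_ _
      rw [SimpleGraph.Walk.support_reverse, List.mem_reverse]
      exact fun h => hb 2 (hrbox _ h)
  · -- vertices other than `b i` lie in the box
    intro i y hy hyb
    rcases (hAX i y).1 hy with hyX | rfl
    · exact hXbox i y hyX
    · exact absurd rfl hyb
  · -- pairwise meeting only in `w`
    intro i j hij y hy hy'
    rcases (hAX i y).1 hy with hyX | rfl
    · rcases (hAX j y).1 hy' with hyX' | rfl
      · exact hXw i j hij y hyX hyX'
      · exact absurd (hXbox i _ hyX) (hb j)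
    · rcases (hAX j (b i)).1 hy' with hyX' | hbb
      · exact absurd (hXbox j _ hyX') (hb i)
      · exact absurd hbb (hne i j hij)

end Summit.Ventures.PercRepro0.Tripod
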